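import Mathlib
import Summits.KontsevichZagierPeriods.KontsevichZagierPeriods.Theorems.InverseLandauTateFamilyKernelRationalCertificate
import Summits.KontsevichZagierPeriods.KontsevichZagierPeriods.Theorems.InverseLandauTateFamilyKernelStubAssembly

/-!
# Crux `TateFamilyKernel` (stmt-KontsevichZagierPeriods-9130), line `Sketch` — stub `stub_hyperoctahedral`

Kind (d) of the trichotomy normal form in the lead's skeleton of the crux
`Summit.KontsevichZagierPeriods.KontsevichZagierPeriods.Theses.InverseLandau.TateFamilyKernel`
(route `InverseLandau`): SYMMETRY terms in general.

For a tame `h` on the closed cube `[0,1]^D` (analytic near the cube, `ℚ`-semialgebraic on it) and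
an element `g = (σ, S)` of the hyperoctahedral group of the cube,
`(g w)_t = 1 − w_{σ t}` if `t ∈ S` and `(g w)_t = w_{σ t}` otherwise, the function `h − h ∘ g` is
tame and every tame cube representation of it is a Kontsevich–Zagier relation.

* tameness of `h ∘ g`: `g` is an affine map (`AnalyticAt.pi` of its coordinates) and a polynomial
  substitution with `ℚ`-coefficients (`isSemialgebraicMapOn_aeval`) preserving the cube;
* relations, by induction on `S`: `S = ∅` is one coordinate permutation
  (`tame_sub_comp_equiv_mem_relations`); for `j ∉ S`, `g_{insert j S} = ρ_j ∘ g_S` with `ρ_j` the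
  box reflection `x_j ↦ 1 − x_j`, so
  `h − h ∘ g_{insert j S} = (h − h ∘ ρ_j) + (h' − h' ∘ g_S)`, `h' = h ∘ ρ_j` tame: the first summand
  is a relation by `tame_sub_boxReflection_mem_relations`, the second by the induction hypothesis,
  and the sum by linearity (`tame_add_sum_mem_relations`).

References: Kontsevich–Zagier 2001, §1.2 rules (1)–(2). No named fact, no new definition.
-/

noncomputable section
open MeasureTheory Set MvPolynomial
open Literature.NumberTheory.Transcendental
open Literature.ModelTheory.ExponentialFields (IsSemialgebraic)
namespace Summit.KontsevichZagierPeriods.InverseLandau.TateFamilyKernel.Descent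

variable {D : ℕ}

/-! ### The hyperoctahedral maps of the cube -/

/-- Adding a reflection: for `j ∉ S`, `g_{(σ, insert j S)} = ρ_j ∘ g_{(σ, S)}` with `ρ_j` the box
reflection `x_j ↦ 1 − x_j`. [folklore] -/
theorem hyperoctahedral_insert (σ : Equiv.Perm (Fin D)) {S : Finset (Fin D)} {j : Fin D}
    (hj : j ∉ S) (w : Fin D → ℝ) :
    (fun t => if t ∈ insert j S then 1 - w (σ t) else w (σ t)) =
      KZ.boxReflection j (fun t => if t ∈ S then 1 - w (σ t) else w (σ t)) := by
  funext t
  by_cases ht : t = j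
  · subst ht
    simp [hj]
  · rw [KZ.boxReflection_apply_of_ne ht]
    simp [Finset.mem_insert, ht]

/-- A hyperoctahedral map preserves the closed cube. [folklore] -/
theorem hyperoctahedral_mem_cube (σ : Equiv.Perm (Fin D)) (S : Finset (Fin D)) {w : Fin D → ℝ}
    (hw : w ∈ KZ.cube D) : (fun t => if t ∈ S then 1 - w (σ t) else w (σ t)) ∈ KZ.cube D := by
  intro t
  have h := KZ.mem_cube.1 hw (σ t)
  by_cases ht : t ∈ S
  · simp only [ht, if_true]
    constructor <;> linarith [h.1, h.2]
  · simp only [ht, if_false]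
    exact h

/-- A hyperoctahedral map is affine, in particular analytic. [folklore] -/
theorem analyticAt_hyperoctahedral (σ : Equiv.Perm (Fin D)) (S : Finset (Fin D)) (w : Fin D → ℝ) :
    AnalyticAt ℝ (fun w : Fin D → ℝ => fun t => if t ∈ S then 1 - w (σ t) else w (σ t)) w := by
  refine AnalyticAt.pi (f := fun t (w : Fin D → ℝ) => if t ∈ S then 1 - w (σ t) else w (σ t))
    fun t => ?_
  have hp : AnalyticAt ℝ (fun w : Fin D → ℝ => w (σ t)) w :=
    (ContinuousLinearMap.proj (R := ℝ) (φ := fun _ : Fin D => ℝ) (σ t)).analyticAt w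
  by_cases ht : t ∈ S
  · simp only [ht, if_true]
    exact analyticAt_const.sub hp
  · simp only [ht, if_false]
    exact hp

/-- A hyperoctahedral map is a polynomial substitution with `ℚ`-coefficients, in particular a
`ℚ`-semialgebraic map on the cube. [cite: BochnakCosteRoy1998, §2.2] -/
theorem isSemialgebraicMapOn_hyperoctahedral (σ : Equiv.Perm (Fin D)) (S : Finset (Fin D)) :
    IsSemialgebraicMapOn ℚ (KZ.cube D)
      (fun w : Fin D → ℝ => fun t => if t ∈ S then 1 - w (σ t) else w (σ t)) := by
  convert isSemialgebraicMapOn_aeval (R := ℝ) KZ.isSemialgebraic_cube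
    (fun t => if t ∈ S then 1 - X (σ t) else (X (σ t) : MvPolynomial (Fin D) ℚ)) using 2 with z
  funext t
  by_cases ht : t ∈ S
  · simp [ht]
  · simp [ht]

/-- A function analytic near the cube stays analytic near the cube after a hyperoctahedral change
of variables. [folklore] -/
theorem analyticOnNhd_comp_hyperoctahedral (σ : Equiv.Perm (Fin D)) (S : Finset (Fin D))
    {h : (Fin D → ℝ) → ℝ} (hha : AnalyticOnNhd ℝ h (KZ.cube D)) :
    AnalyticOnNhd ℝ (fun w : Fin D → ℝ => h (fun t => if t ∈ S then 1 - w (σ t) else w (σ t)))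
      (KZ.cube D) :=
  fun w hw => (hha _ (hyperoctahedral_mem_cube σ S hw)).comp (analyticAt_hyperoctahedral σ S w)

/-- A `ℚ`-semialgebraic function on the cube stays `ℚ`-semialgebraic after a hyperoctahedral
change of variables. [cite: BochnakCosteRoy1998, Prop. 2.2.6] -/
theorem isSemialgebraicFunOn_comp_hyperoctahedral (σ : Equiv.Perm (Fin D)) (S : Finset (Fin D))
    {h : (Fin D → ℝ) → ℝ} (hhs : IsSemialgebraicFunOn ℚ (KZ.cube D) h) :
    IsSemialgebraicFunOn ℚ (KZ.cube D)
      (fun w : Fin D → ℝ => h (fun t => if t ∈ S then 1 - w (σ t) else w (σ t))) :=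
  IsSemialgebraicFunOn.comp_isSemialgebraicMapOn_holds hhs (isSemialgebraicMapOn_hyperoctahedral σ S)
    fun _ hw => hyperoctahedral_mem_cube σ S hw

/-- A function analytic near the cube stays analytic near the cube after a box reflection.
[folklore] -/
theorem analyticOnNhd_comp_boxReflection (j : Fin D) {h : (Fin D → ℝ) → ℝ}
    (hha : AnalyticOnNhd ℝ h (KZ.cube D)) :
    AnalyticOnNhd ℝ (fun x => h (KZ.boxReflection j x)) (KZ.cube D) := fun x hx =>
  (hha _ (boxReflection_mem_cube j hx)).comp (analyticAt_boxReflection j x)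

/-- A `ℚ`-semialgebraic function on the cube stays `ℚ`-semialgebraic after a box reflection.
[cite: BochnakCosteRoy1998, Prop. 2.2.6] -/
theorem isSemialgebraicFunOn_comp_boxReflection (j : Fin D) {h : (Fin D → ℝ) → ℝ}
    (hhs : IsSemialgebraicFunOn ℚ (KZ.cube D) h) :
    IsSemialgebraicFunOn ℚ (KZ.cube D) (fun x => h (KZ.boxReflection j x)) := by
  have hmap : IsSemialgebraicMapOn ℚ (KZ.cube D) (KZ.boxReflection j) := by
    convert isSemialgebraicMapOn_aeval (R := ℝ) KZ.isSemialgebraic_cube (KZ.reflectSubst j) using 2 with z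
    exact (KZ.aeval_reflectSubst_eq j z).symm
  exact IsSemialgebraicFunOn.comp_isSemialgebraicMapOn_holds hhs hmap fun x hx =>
    boxReflection_mem_cube j hx

/-! ### Rule (2): hyperoctahedral symmetries of tame data are relations -/

/-- **Hyperoctahedral symmetry, relations.** For tame `h` on `[0,1]^D` and `g = (σ, S)` in the
hyperoctahedral group, every tame cube representation of `h − h ∘ g` is a relation (induction on
`S`: one coordinate permutation, then one box reflection at a time, glued by linearity).
[cite: KontsevichZagier2001, §1.2 rule (2)] -/
theorem tame_sub_comp_hyperoctahedral_mem_relations (σ : Equiv.Perm (Fin D)) (S : Finset (Fin D)) :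
    ∀ {h : (Fin D → ℝ) → ℝ}, AnalyticOnNhd ℝ h (KZ.cube D) → IsSemialgebraicFunOn ℚ (KZ.cube D) h →
      ∀ R : KZ.IntegralRep D, R.IsTameCube →
        (∀ w ∈ KZ.cube D, R.integrand w =
          h w - h (fun t => if t ∈ S then 1 - w (σ t) else w (σ t))) →
        KZ.of R ∈ KZ.relations := by
  induction S using Finset.induction_on with
  | empty =>
    intro h hha hhs R hR hRi
    exact tame_sub_comp_equiv_mem_relations σ hha hhs R hR fun w hw => by simpa using hRi w hw
  | insert j S hj ih =>
    intro h hha hhs R hR hRi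
    -- `h' = h ∘ ρ_j` is tame
    have hra := analyticOnNhd_comp_boxReflection j hha
    have hrs := isSemialgebraicFunOn_comp_boxReflection j hhs
    refine tame_add_sum_mem_relations ({()} : Finset Unit)
      (g := fun w => h w - h (KZ.boxReflection j w))
      (fun T hT hTi => tame_sub_boxReflection_mem_relations j hha hhs T hT hTi)
      (H := fun _ w => h (KZ.boxReflection j w) -
        h (KZ.boxReflection j (fun t => if t ∈ S then 1 - w (σ t) else w (σ t))))
      (fun _ _ => hra.sub (analyticOnNhd_comp_hyperoctahedral σ S hra))
      (fun _ _ => IsSemialgebraicFunOn.sub_holds hrs (isSemialgebraicFunOn_comp_hyperoctahedral σ S hrs))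
      (fun _ _ T hT hTi => ih hra hrs T hT hTi) R hR fun w hw => ?_
    rw [hRi w hw, Finset.sum_singleton, hyperoctahedral_insert σ hj w]
    ring

/-- STUB `stub_hyperoctahedral` of line `Sketch` — **kind (d) in general.** For tame `h` on
`[0,1]^D` and an element `g = (σ, S)` of the hyperoctahedral group of the cube
(`(g w)_t = 1 − w_{σ t}` if `t ∈ S`, `= w_{σ t}` otherwise), `h − h ∘ g` is tame and every tame cube
representation of it is a relation (induction on `S`: `tame_sub_comp_equiv_mem_relations`,
`tame_sub_boxReflection_mem_relations`, linearity). [cite: KontsevichZagier2001, §1.2 rule (2)] -/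
theorem stub_hyperoctahedral {D : ℕ} (σ : Equiv.Perm (Fin D)) (S : Finset (Fin D))
    {h : (Fin D → ℝ) → ℝ} (hha : AnalyticOnNhd ℝ h (KZ.cube D))
    (hhs : IsSemialgebraicFunOn ℚ (KZ.cube D) h) :
    AnalyticOnNhd ℝ (fun w : Fin D → ℝ =>
        h w - h (fun t => if t ∈ S then 1 - w (σ t) else w (σ t))) (KZ.cube D) ∧
      IsSemialgebraicFunOn ℚ (KZ.cube D) (fun w : Fin D → ℝ =>
        h w - h (fun t => if t ∈ S then 1 - w (σ t) else w (σ t))) ∧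
      ∀ R : KZ.IntegralRep D, R.IsTameCube →
        (∀ w ∈ KZ.cube D, R.integrand w =
          h w - h (fun t => if t ∈ S then 1 - w (σ t) else w (σ t))) →
        KZ.of R ∈ KZ.relations :=
  ⟨hha.sub (analyticOnNhd_comp_hyperoctahedral σ S hha),
    IsSemialgebraicFunOn.sub_holds hhs (isSemialgebraicFunOn_comp_hyperoctahedral σ S hhs),
    fun R hR hRi => tame_sub_comp_hyperoctahedral_mem_relations σ S hha hhs R hR hRi⟩

end Summit.KontsevichZagierPeriods.InverseLandau.TateFamilyKernel.Descent

end
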